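import Mathlib
import Summits.KontsevichZagierPeriods.Zeta5Search.LaiSavingCells
import Literature.NumberTheory.Transcendental.ZudilinPhi
import HarnessLib

/-!
# A decidable per-cell admissibility check for the saving factor (strip certificates for Lai's `φ̃`)

Sub-problem `KontsevichZagierPeriods/Zeta5Search`, family `fam-indep` (linear independence /
dimension), generation 5. Systematic search; no irrationality claim unless certified.

`LaiKappa3Cells.lean` reduces 'κ₃ ≤ 73' to ONE `Kappa3CellCert`, all of whose fields are decidable
rational / Boolean statements except the per-cell ADMISSIBILITY `SavingCell.Adm J r M δ dmin C`
(the cell's exponent `c` is a lower bound of Lai's brick exponent `laiPhiDiv J r M n δ k p = φ̃(n/p, k/p)`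
for every prime `p` of the class `{n/p} ∈ [u, v)` and every `k`). This file makes that field decidable,
by porting the STRIP CHECKER certifying Zudilin's `φ`-table in the tree
(`Literature.NumberTheory.Transcendental.ZudilinPhi`: `PhiCert.Term`, `Line`, `Term.lb`, `Cell.check`)
to an arbitrary list of floor terms and to LEFT-CLOSED cells `[u, v)`:
* `laiTerms J r M δ` — the `5 + 3J` floor terms of `φ̃`; `laiPhiDiv_eq_evalSum`; periodicity in `x`
  (needs `2δ_j ≤ M`) and `y`, hence reduction to `x = (n mod p)/p`, `y = (k mod p)/p`;
* `lbL` / `stripLBL` / `checkL` / `checkL_sound` — the left-closed strip bound and checker (the only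
  change w.r.t. `PhiCert.Term.lb` is the `⌊a x − y⌋`, negative-coefficient branch, which splits on the
  sign of the slope `a − lo.s` instead of using strict inequalities at both ends);
* **`SavingCell.adm_of_checkAdm`**: `(∀ j, 2δ_j < M) → C.checkAdm (laiTerms J r M δ) lines = true →
  C.Adm J r M δ dmin` — so a `Kappa3CellCert` is DATA (cells + dividing lines) plus `decide +kernel`
  (measured: ≈ 13 s of kernel time per cell of the κ₃ table with ≈ 130 dividing lines; see the
  family notes for the faster sorted-threshold variant).

HONEST FRAMING: a checker and its soundness theorem; no cell of the κ₃ table is certified here and no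
claim about `ζ(5)` or about 'κ₃ ≤ 73' is made. References: [Zudilin2004] §8 pp. 270–271 (the
`φ`-table verified strip by strip); [Lai2024BallRivoal] arXiv:2407.14236, §4 (4.5)–(4.6), Lemma 4.3.
-/
open Finset Filter
open Literature.NumberTheory.Transcendental.Zudilin2004.PhiCert

namespace Summit.KontsevichZagierPeriods.Zeta5Search

namespace SavingCheck

/-! ### `φ̃` as a list of floor terms -/

/-- The `5 + 3J` floor terms of Lai's `φ̃(x, y) = ⌊y + rx⌋ + ⌊(r+M)x − y⌋ − ⌊y⌋ − ⌊Mx − y⌋ − 2r⌊x⌋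
+ Σ_j (⌊(M−2δ_j)x⌋ − ⌊y − δ_j x⌋ − ⌊(M−δ_j)x − y⌋)`, in the format of `PhiCert.Term`
(`yax = ⌊y − a x⌋`, `axy = ⌊a x − y⌋`, `ax = ⌊a x⌋`). [cite: Lai2024BallRivoal, §4 (4.6)] -/
def laiTerms (J r M : ℕ) (δ : Fin J → ℕ) : List Term :=
  [⟨1, .yax, -(r : ℤ)⟩, ⟨1, .axy, (r : ℤ) + M⟩, ⟨-1, .yax, 0⟩, ⟨-1, .axy, (M : ℤ)⟩, ⟨-2 * (r : ℤ), .ax, 1⟩]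
    ++ List.ofFn (fun j : Fin J => (⟨1, .ax, ((M - 2 * δ j : ℕ) : ℤ)⟩ : Term))
    ++ List.ofFn (fun j : Fin J => (⟨-1, .yax, (δ j : ℤ)⟩ : Term))
    ++ List.ofFn (fun j : Fin J => (⟨-1, .axy, ((M - δ j : ℕ) : ℤ)⟩ : Term))

/-- The value of a term list at `(x, y)`. [folklore] -/
def evalSum (ts : List Term) (x y : ℚ) : ℤ := (ts.map fun T => T.eval x y).sum

/-- **`laiPhiDiv` is the term sum at `(n/p, k/p)`** (integer division = floor; for `p = 0` both
sides are junk values and still agree). [cite: Lai2024BallRivoal, §4 (4.6)] -/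
theorem laiPhiDiv_eq_evalSum (J r M n : ℕ) (δ : Fin J → ℕ) (k p : ℕ) :
    laiPhiDiv J r M n δ k p = evalSum (laiTerms J r M δ) ((n : ℚ) / p) ((k : ℚ) / p) := by
  have e : ∀ A : ℤ, A / (p : ℤ) = ⌊(A : ℚ) / (p : ℚ)⌋ := fun A =>
    (Rat.floor_intCast_div_natCast A p).symm
  unfold laiPhiDiv
  simp only [e, evalSum, laiTerms, List.map_append, List.map_cons, List.map_nil, List.sum_append,
    List.sum_cons, List.sum_nil, List.map_ofFn, List.sum_ofFn, Function.comp_def, Term.eval,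
    Finset.sum_sub_distrib, neg_mul, one_mul, Finset.sum_neg_distrib]
  push_cast
  have t1 : (((k : ℚ) + r * n) / p) = (k : ℚ) / p - (-(r : ℚ)) * ((n : ℚ) / p) := by ring
  have t2 : (((r : ℚ) + M) * n - k) / p = ((r : ℚ) + M) * ((n : ℚ) / p) - (k : ℚ) / p := by ring
  have t4 : ((M : ℚ) * n - k) / p = (M : ℚ) * ((n : ℚ) / p) - (k : ℚ) / p := by ring
  have t5 : ∀ j : Fin J, (((M - 2 * δ j : ℕ) : ℚ) * n) / p = ((M - 2 * δ j : ℕ) : ℚ) * ((n : ℚ) / p) :=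
    fun j => by ring
  have t6 : ∀ j : Fin J, ((k : ℚ) - (δ j : ℚ) * n) / p = (k : ℚ) / p - (δ j : ℚ) * ((n : ℚ) / p) :=
    fun j => by ring
  have t7 : ∀ j : Fin J, (((M - δ j : ℕ) : ℚ) * n - k) / p = ((M - δ j : ℕ) : ℚ) * ((n : ℚ) / p) - (k : ℚ) / p :=
    fun j => by ring
  rw [t1, t2, t4]
  simp only [t5, t6, t7]
  ring_nf

/-- The `x`-shift of a floor term: `T.eval (x + m) y = T.eval x y + T.xshift · m`. [folklore] -/
def xshift (T : Term) : ℤ :=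
  T.coef * (match T.kind with | .yax => -T.a | .axy => T.a | .ax => T.a)

/-- The `y`-shift of a floor term: `T.eval x (y + m) = T.eval x y + T.yshift · m`. [folklore] -/
def yshift (T : Term) : ℤ :=
  T.coef * (match T.kind with | .yax => 1 | .axy => -1 | .ax => 0)

/-- Shifting `x` by an integer. [folklore] -/
theorem eval_add_int_left (T : Term) (x y : ℚ) (m : ℤ) :
    T.eval (x + m) y = T.eval x y + xshift T * m := by
  rcases T with ⟨coef, kind, a⟩
  cases kind with
  | yax =>
    simp only [Term.eval, xshift]
    rw [show y - (a : ℚ) * (x + m) = (y - a * x) - ((a * m : ℤ) : ℚ) by push_cast; ring,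
      Int.floor_sub_intCast]; ring
  | axy =>
    simp only [Term.eval, xshift]
    rw [show (a : ℚ) * (x + m) - y = (a * x - y) + ((a * m : ℤ) : ℚ) by push_cast; ring,
      Int.floor_add_intCast]; ring
  | ax =>
    simp only [Term.eval, xshift]
    rw [show (a : ℚ) * (x + m) = a * x + ((a * m : ℤ) : ℚ) by push_cast; ring,
      Int.floor_add_intCast]; ring

/-- Shifting `y` by an integer. [folklore] -/
theorem eval_add_int_right (T : Term) (x y : ℚ) (m : ℤ) :
    T.eval x (y + m) = T.eval x y + yshift T * m := by
  rcases T with ⟨coef, kind, a⟩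
  cases kind with
  | yax =>
    simp only [Term.eval, yshift]
    rw [show y + (m : ℚ) - (a : ℚ) * x = (y - a * x) + (m : ℚ) by ring, Int.floor_add_intCast]; ring
  | axy =>
    simp only [Term.eval, yshift]
    rw [show (a : ℚ) * x - (y + m) = (a * x - y) - (m : ℚ) by ring, Int.floor_sub_intCast]; ring
  | ax => simp [Term.eval, yshift]

/-- Shifting a term sum. [folklore] -/
theorem evalSum_add_int_left (ts : List Term) (x y : ℚ) (m : ℤ) :
    evalSum ts (x + m) y = evalSum ts x y + (ts.map xshift).sum * m := by
  induction ts with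
  | nil => simp [evalSum]
  | cons T ts ih =>
    simp only [evalSum, List.map_cons, List.sum_cons] at ih ⊢
    rw [eval_add_int_left, ih]; ring

/-- Shifting a term sum. [folklore] -/
theorem evalSum_add_int_right (ts : List Term) (x y : ℚ) (m : ℤ) :
    evalSum ts x (y + m) = evalSum ts x y + (ts.map yshift).sum * m := by
  induction ts with
  | nil => simp [evalSum]
  | cons T ts ih =>
    simp only [evalSum, List.map_cons, List.sum_cons] at ih ⊢
    rw [eval_add_int_right, ih]; ring

/-- The total `x`-shift of `φ̃` vanishes (`2δ_j ≤ M`): `φ̃` is `1`-periodic in `x`.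
[cite: Lai2024BallRivoal, §4 (4.6)] -/
theorem laiTerms_xshift (J r M : ℕ) (δ : Fin J → ℕ) (hδ : ∀ j, 2 * δ j ≤ M) :
    ((laiTerms J r M δ).map xshift).sum = 0 := by
  simp only [laiTerms, List.map_append, List.map_cons, List.map_nil, List.sum_append, List.sum_cons,
    List.sum_nil, List.map_ofFn, List.sum_ofFn, Function.comp_def, xshift]
  have h : ∀ j : Fin J, (1 : ℤ) * ((M - 2 * δ j : ℕ) : ℤ) + (-1) * (-(δ j : ℤ)) + (-1) * ((M - δ j : ℕ) : ℤ) = 0 := by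
    intro j
    have h1 := hδ j
    push_cast [Nat.cast_sub h1, Nat.cast_sub (by omega : δ j ≤ M)]
    ring
  have : ∑ j : Fin J, (1 : ℤ) * ((M - 2 * δ j : ℕ) : ℤ) + ∑ j : Fin J, (-1) * (-(δ j : ℤ))
      + ∑ j : Fin J, (-1) * ((M - δ j : ℕ) : ℤ) = 0 := by
    rw [← Finset.sum_add_distrib, ← Finset.sum_add_distrib]
    exact Finset.sum_eq_zero fun j _ => h j
  linear_combination this

/-- The total `y`-shift of `φ̃` vanishes: `φ̃` is `1`-periodic in `y`. [cite: Lai2024BallRivoal, §4 (4.6)] -/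
theorem laiTerms_yshift (J r M : ℕ) (δ : Fin J → ℕ) : ((laiTerms J r M δ).map yshift).sum = 0 := by
  simp only [laiTerms, List.map_append, List.map_cons, List.map_nil, List.sum_append, List.sum_cons,
    List.sum_nil, List.map_ofFn, List.sum_ofFn, Function.comp_def, yshift]
  simp

/-- Reduction of `φ̃` to the fundamental domain. [cite: Lai2024BallRivoal, §4 (4.6)] -/
theorem laiTerms_evalSum_fract (J r M : ℕ) (δ : Fin J → ℕ) (hδ : ∀ j, 2 * δ j ≤ M) (x y : ℚ) :
    evalSum (laiTerms J r M δ) x y = evalSum (laiTerms J r M δ) (Int.fract x) (Int.fract y) := by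
  conv_lhs => rw [← Int.fract_add_floor x, ← Int.fract_add_floor y]
  rw [evalSum_add_int_left, laiTerms_xshift J r M δ hδ, evalSum_add_int_right, laiTerms_yshift]
  simp

/-- The `⌊a x⌋`-terms of `φ̃` have positive slope when `2δ_j < M`. [folklore] -/
theorem laiTerms_ok (J r M : ℕ) (δ : Fin J → ℕ) (hδ : ∀ j, 2 * δ j < M) :
    ∀ T ∈ laiTerms J r M δ, T.ok := by
  intro T hT
  simp only [laiTerms, List.mem_append, List.mem_cons, List.not_mem_nil, or_false,
    List.mem_ofFn] at hT
  rcases hT with ((h | h) | h) | h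
  · rcases h with rfl | rfl | rfl | rfl | rfl <;> simp [Term.ok]
  · obtain ⟨j, rfl⟩ := h
    have := hδ j
    simp only [Term.ok, forall_const]
    exact_mod_cast (by omega : 0 < M - 2 * δ j)
  · obtain ⟨j, rfl⟩ := h; simp [Term.ok]
  · obtain ⟨j, rfl⟩ := h; simp [Term.ok]

/-! ### The left-closed strip checker for a generic term list -/

/-- Lower bound of a floor term on `a₀/b₀ ≤ x < a₁/b₁`, `lo(x) ≤ y < hi(x)` from endpoint data only
(left-closed variant of `PhiCert.Term.lb`). [cite: Zudilin2004, §8 p. 270] -/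
def lbL (T : Term) (a0 : ℤ) (b0 : ℕ) (a1 : ℤ) (b1 : ℕ) (lo hi : Line) : ℤ :=
  match T.kind with
  | .yax =>
      if 0 ≤ T.coef then T.coef * min (fl (lo.num T.a a0 b0) b0) (fl (lo.num T.a a1 b1) b1)
      else T.coef * max (flm1 (hi.num T.a a0 b0) b0) (flm1 (hi.num T.a a1 b1) b1)
  | .axy =>
      if 0 ≤ T.coef then T.coef * min (fl (-hi.num T.a a0 b0) b0) (fl (-hi.num T.a a1 b1) b1)
      else if T.a ≤ lo.s then T.coef * fl (-lo.num T.a a0 b0) b0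
      else T.coef * flm1 (-lo.num T.a a1 b1) b1
  | .ax => if 0 ≤ T.coef then T.coef * fl (T.a * a0) b0 else T.coef * flm1 (T.a * a1) b1

/-- The certified lower bound of a term list on a strip. [cite: Zudilin2004, §8 p. 270] -/
def stripLBL (ts : List Term) (a0 : ℤ) (b0 : ℕ) (a1 : ℤ) (b1 : ℕ) (lo hi : Line) : ℤ :=
  (ts.map fun T => lbL T a0 b0 a1 b1 lo hi).sum

/-- Check the strips from the line `lo` upwards against the claimed bound `c`. [cite: Zudilin2004, §8 p. 271] -/
def goL (ts : List Term) (a0 : ℤ) (b0 : ℕ) (a1 : ℤ) (b1 : ℕ) (c : ℤ) : Line → List Line → Bool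
  | l₁, [] => decide (c ≤ stripLBL ts a0 b0 a1 b1 l₁ ⟨0, 1⟩)
  | l₁, l₂ :: rest => decide (c ≤ stripLBL ts a0 b0 a1 b1 l₁ l₂) && goL ts a0 b0 a1 b1 c l₂ rest

/-- The left-closed cell checker: `c ≤ Σ_T T.eval x y` on `[a₀/b₀, a₁/b₁) × [0, 1)`, certified strip by
strip along the given dividing lines (bottom to top). [cite: Zudilin2004, §8 p. 271] -/
def checkL (ts : List Term) (a0 : ℤ) (b0 : ℕ) (a1 : ℤ) (b1 : ℕ) (c : ℤ) (lines : List Line) : Bool :=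
  decide (0 < b0) && decide (0 < b1) && goL ts a0 b0 a1 b1 c ⟨0, 0⟩ lines

/-- An affine function on a closed interval lies between its endpoint values. [folklore] -/
theorem affine_mem_of_le {α β x0 x1 x : ℚ} (h0 : x0 ≤ x) (h1 : x ≤ x1) :
    min (α * x0 + β) (α * x1 + β) ≤ α * x + β ∧ α * x + β ≤ max (α * x0 + β) (α * x1 + β) := by
  rcases le_total 0 α with hα | hα
  · have h0' : α * x0 ≤ α * x := mul_le_mul_of_nonneg_left h0 hα
    have h1' : α * x ≤ α * x1 := mul_le_mul_of_nonneg_left h1 hα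
    exact ⟨(min_le_left _ _).trans (by linarith), le_trans (by linarith) (le_max_right _ _)⟩
  · have h0' : α * x ≤ α * x0 := mul_le_mul_of_nonpos_left h0 hα
    have h1' : α * x1 ≤ α * x := mul_le_mul_of_nonpos_left h1 hα
    exact ⟨(min_le_right _ _).trans (by linarith), le_trans (by linarith) (le_max_left _ _)⟩

/-- **Soundness of the left-closed term bound.** [cite: Zudilin2004, §8 p. 270] -/
theorem lbL_le (T : Term) (hT : T.ok) {a0 a1 : ℤ} {b0 b1 : ℕ} (hb0 : 0 < b0) (hb1 : 0 < b1)
    {lo hi : Line} {x y : ℚ} (hx0 : (a0 : ℚ) / b0 ≤ x) (hx1 : x < (a1 : ℚ) / b1)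
    (hlo : lo.eval x ≤ y) (hhi : y < hi.eval x) :
    lbL T a0 b0 a1 b1 lo hi ≤ T.eval x y := by
  have Hlo := affine_mem_of_le (α := (lo.s : ℚ) - T.a) (β := lo.t) hx0 hx1.le
  have Hhi := affine_mem_of_le (α := (hi.s : ℚ) - T.a) (β := hi.t) hx0 hx1.le
  have elo0 := lo.eval_sub_mul T.a a0 hb0
  have elo1 := lo.eval_sub_mul T.a a1 hb1
  have ehi0 := hi.eval_sub_mul T.a a0 hb0
  have ehi1 := hi.eval_sub_mul T.a a1 hb1
  simp only [Line.eval] at elo0 elo1 ehi0 ehi1 hlo hhi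
  have klo : ∀ z : ℚ, ((lo.s : ℚ) - T.a) * z + lo.t = (lo.s * z + lo.t) - T.a * z := fun z => by ring
  have khi : ∀ z : ℚ, ((hi.s : ℚ) - T.a) * z + hi.t = (hi.s * z + hi.t) - T.a * z := fun z => by ring
  simp only [klo, khi, elo0, elo1, ehi0, ehi1] at Hlo Hhi
  unfold lbL Term.eval
  rcases T with ⟨coef, kind, a⟩
  simp only at *
  cases kind with
  | yax =>
    simp only
    split_ifs with hc
    · exact mul_le_mul_of_nonneg_left (min_fl_le_floor (Hlo.1.trans (by linarith))) hc
    · exact mul_le_mul_of_nonpos_left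
        (floor_le_max_flm1 hb0 hb1 (lt_of_lt_of_le (by linarith) Hhi.2)) (le_of_lt (not_le.1 hc))
  | axy =>
    simp only
    split_ifs with hc hs
    · refine mul_le_mul_of_nonneg_left (min_fl_le_floor ?_) hc
      have : min (-((hi.num a a0 b0 : ℚ) / b0)) (-((hi.num a a1 b1 : ℚ) / b1)) ≤ a * x - y := by
        rw [min_neg_neg]; linarith [Hhi.2]
      simpa [neg_div] using this
    · -- slope `a - lo.s ≤ 0`: `a x - lo(x)` is maximal at the LEFT endpoint (attained)
      refine mul_le_mul_of_nonpos_left (floor_le_fl ?_) (le_of_lt (not_le.1 hc))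
      have hs' : (a : ℚ) - lo.s ≤ 0 := by exact_mod_cast (sub_nonpos.2 hs)
      have hmono : ((a : ℚ) - lo.s) * x ≤ ((a : ℚ) - lo.s) * ((a0 : ℚ) / b0) :=
        mul_le_mul_of_nonpos_left hx0 hs'
      have k0 : ((a : ℚ) - lo.s) * ((a0 : ℚ) / b0) - lo.t = -((lo.num a a0 b0 : ℚ) / b0) := by
        rw [← elo0]; ring
      have : (a : ℚ) * x - y ≤ -((lo.num a a0 b0 : ℚ) / b0) := by nlinarith [hlo, hmono, k0]
      simpa [neg_div] using this
    · -- slope `a - lo.s > 0`: `a x - lo(x)` is strictly below its value at the RIGHT endpoint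
      refine mul_le_mul_of_nonpos_left (floor_le_flm1 hb1 ?_) (le_of_lt (not_le.1 hc))
      have hs' : (0 : ℚ) < (a : ℚ) - lo.s := by exact_mod_cast (sub_pos.2 (not_le.1 hs))
      have hmono : ((a : ℚ) - lo.s) * x < ((a : ℚ) - lo.s) * ((a1 : ℚ) / b1) :=
        mul_lt_mul_of_pos_left hx1 hs'
      have k1 : ((a : ℚ) - lo.s) * ((a1 : ℚ) / b1) - lo.t = -((lo.num a a1 b1 : ℚ) / b1) := by
        rw [← elo1]; ring
      have : (a : ℚ) * x - y < -((lo.num a a1 b1 : ℚ) / b1) := by nlinarith [hlo, hmono, k1]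
      simpa [neg_div] using this
  | ax =>
    have ha : (0 : ℚ) < a := by exact_mod_cast hT rfl
    simp only
    split_ifs with hc
    · refine mul_le_mul_of_nonneg_left (fl_le_floor ?_) hc
      have : (a : ℚ) * ((a0 : ℚ) / b0) ≤ a * x := mul_le_mul_of_nonneg_left hx0 ha.le
      push_cast
      linarith [this, mul_div_assoc (a : ℚ) a0 b0]
    · refine mul_le_mul_of_nonpos_left (floor_le_flm1 hb1 ?_) (le_of_lt (not_le.1 hc))
      have : (a : ℚ) * x < a * ((a1 : ℚ) / b1) := mul_lt_mul_of_pos_left hx1 ha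
      push_cast
      linarith [this, mul_div_assoc (a : ℚ) a1 b1]

/-- **Soundness of the strip bound.** [cite: Zudilin2004, §8 p. 270] -/
theorem stripLBL_le {ts : List Term} (hts : ∀ T ∈ ts, T.ok) {a0 a1 : ℤ} {b0 b1 : ℕ} (hb0 : 0 < b0)
    (hb1 : 0 < b1) {lo hi : Line} {x y : ℚ} (hx0 : (a0 : ℚ) / b0 ≤ x) (hx1 : x < (a1 : ℚ) / b1)
    (hlo : lo.eval x ≤ y) (hhi : y < hi.eval x) :
    stripLBL ts a0 b0 a1 b1 lo hi ≤ evalSum ts x y := by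
  rw [stripLBL, evalSum]
  exact sum_map_le_sum_map ts fun T hT => lbL_le T (hts T hT) hb0 hb1 hx0 hx1 hlo hhi

/-- Soundness of the strip recursion. [cite: Zudilin2004, §8 p. 271] -/
theorem goL_sound {ts : List Term} (hts : ∀ T ∈ ts, T.ok) {a0 a1 : ℤ} {b0 b1 : ℕ} {c : ℤ}
    (hb0 : 0 < b0) (hb1 : 0 < b1) {x y : ℚ} (hx0 : (a0 : ℚ) / b0 ≤ x) (hx1 : x < (a1 : ℚ) / b1)
    (hy1 : y < 1) :
    ∀ (rest : List Line) (lo : Line), lo.eval x ≤ y → goL ts a0 b0 a1 b1 c lo rest = true →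
      c ≤ evalSum ts x y := by
  intro rest
  induction rest with
  | nil =>
    intro lo hlo h
    simp only [goL, decide_eq_true_eq] at h
    exact h.trans (stripLBL_le hts hb0 hb1 hx0 hx1 hlo (by simpa [Line.eval] using hy1))
  | cons hi rest ih =>
    intro lo hlo h
    simp only [goL, Bool.and_eq_true, decide_eq_true_eq] at h
    by_cases hy : y < hi.eval x
    · exact h.1.trans (stripLBL_le hts hb0 hb1 hx0 hx1 hlo hy)
    · exact ih hi (not_lt.1 hy) h.2

/-- **Soundness of the left-closed cell checker**: `checkL … = true` gives `c ≤ Σ_T T.eval x y` on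
`[a₀/b₀, a₁/b₁) × [0, 1)`. [cite: Zudilin2004, §8 p. 271] -/
theorem checkL_sound {ts : List Term} (hts : ∀ T ∈ ts, T.ok) {a0 a1 : ℤ} {b0 b1 : ℕ} {c : ℤ}
    {lines : List Line} (h : checkL ts a0 b0 a1 b1 c lines = true) {x y : ℚ}
    (hx0 : (a0 : ℚ) / b0 ≤ x) (hx1 : x < (a1 : ℚ) / b1) (hy0 : 0 ≤ y) (hy1 : y < 1) :
    c ≤ evalSum ts x y := by
  simp only [checkL, Bool.and_eq_true, decide_eq_true_eq] at h
  exact goL_sound hts h.1.1 h.1.2 hx0 hx1 hy1 lines ⟨0, 0⟩ (by simpa [Line.eval] using hy0) h.2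

end SavingCheck

open SavingCheck

/-! ### Admissibility of a cell from a strip certificate -/

/-- The decidable admissibility check of a cell: the left-closed strip checker for the term list on
`[u, v) × [0, 1)` with claimed bound `c`, along the given dividing lines. [cite: Zudilin2004, §8 p. 271] -/
def SavingCell.checkAdm (ts : List Term) (C : SavingCell) (lines : List Line) : Bool :=
  checkL ts C.u.num C.u.den C.v.num C.v.den (C.c : ℤ) lines

/-- **A cell that passes the strip check is admissible** (`SavingCell.Adm`, the per-cell hypothesis of
`laiExpAdmissible_cellExp` and of `Kappa3CellCert`): for every prime `p` of the class `{n/p} ∈ [u, v)`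
and every `k`, `c ≤ laiPhiDiv J r M n δ k p = φ̃({n/p}, {k/p})`. [cite: Lai2024BallRivoal, §4 Lemma 4.3] -/
theorem SavingCell.adm_of_checkAdm (J r M : ℕ) (δ : Fin J → ℕ) (dmin : ℕ) (hδ : ∀ j, 2 * δ j < M)
    (C : SavingCell) (lines : List Line) (h : C.checkAdm (laiTerms J r M δ) lines = true) :
    C.Adm J r M δ dmin := by
  intro n p k _hp _hJ _hpn _hMn _hk1 _hk2 hmem
  have hδ' : ∀ j, 2 * δ j ≤ M := fun j => (hδ j).le
  rw [laiPhiDiv_eq_evalSum J r M n δ k p, laiTerms_evalSum_fract J r M δ hδ']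
  rw [SavingCell.mem_iff] at hmem
  have hfx : Int.fract ((n : ℚ) / p) = ((n % p : ℕ) : ℚ) / p := Int.fract_div_natCast_eq_div_natCast_mod
  refine checkL_sound (laiTerms_ok J r M δ hδ) h ?_ ?_ (Int.fract_nonneg _) (Int.fract_lt_one _)
  · rw [Rat.num_div_den, hfx]; exact hmem.1
  · rw [Rat.num_div_den, hfx]; exact hmem.2

end Summit.KontsevichZagierPeriods.Zeta5Search
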